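import Literature.AlgebraicGeometry.Resolution.Blowups
import Mathlib.AlgebraicGeometry.Restrict
import HarnessLib

/-!
# Stalks of a blowing up off the centre are the stalks downstairs

Support file for crux stmt-ResolutionOfSingularities-15315
(`FrobeniusLadder.FInjectiveMacaulayfication`, line `Sketch`, seat c6): stub
`stub_isBlowupStalkOffSupport` (surgery glue piece: blowing up a centre supported on the finite
bad set changes nothing at the points not over the centre).

Let `π : X' → X` be a blowing up along the ideal sheaf `J` in the sense of the universal property
(`IsBlowup π J`, `Literature/AlgebraicGeometry/Resolution/Blowups.lean`). By Stacks 02OS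
(Görtz–Wedhorn I, Prop. 13.91 (3); the tree's `IsBlowup.isIso_compl`, proved from the universal
property) the restriction `π ∣_ U : π⁻¹(U) → U` over the open complement `U = X ∖ supp J` of the
centre is an isomorphism. For a point `x' ∈ X'` with `π x' ∉ supp J`, i.e. `x' ∈ π⁻¹(U)`, the
stalk map of `π ∣_ U` at `x'` is therefore an isomorphism, and it is identified with the stalk map
`π.stalkMap x' : 𝒪_{X, π x'} → 𝒪_{X', x'}` (Mathlib `morphismRestrictStalkMap`), which is thus an
isomorphism of rings.

* `stub_isBlowupStalkOffSupport` — the registered form, verbatim: the stalk of `X'` at a point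
  not over the centre is ring-isomorphic to the stalk of `X` at its image.

References: The Stacks Project, Tag 02OS; U. Görtz, T. Wedhorn, *Algebraic Geometry I*, 2nd ed.
(2020), Prop. 13.91 (3); folklore (stalk maps of a restricted morphism are the stalk maps).
-/

-- single-problem summit: the doubled namespace component is forced
set_option linter.dupNamespace false

noncomputable section

namespace Summit.ResolutionOfSingularities.ResolutionOfSingularities.Theorems.FInjectiveMacaulayfication.IsBlowupStalkOffSupport

open AlgebraicGeometry CategoryTheory Literature.AlgebraicGeometry.Resolution

/-- The stalk map of a blowing up `π : X' → X` along `J` at a point `x'` not over the centre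
`supp J` is an isomorphism: `π` restricts to an isomorphism over `X ∖ supp J` (Stacks 02OS,
`IsBlowup.isIso_compl`), and the stalk maps of the restriction are the stalk maps of `π`
(`morphismRestrictStalkMap`). [cite: StacksProject, Tag 02OS] -/
theorem isIso_stalkMap_of_not_mem_support {X X' : Scheme.{0}} {J : X.IdealSheafData} {π : X' ⟶ X}
    (hπ : IsBlowup π J) (x' : X') (hx' : π.base x' ∉ (J.support : Set X)) :
    IsIso (π.stalkMap x') := by
  haveI := hπ.isIso_compl
  have hmem : x' ∈ π ⁻¹ᵁ ⟨(J.support : Set X)ᶜ, J.support.isClosed.isOpen_compl⟩ := hx'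
  exact ((MorphismProperty.isomorphisms CommRingCat).arrow_mk_iso_iff
    (morphismRestrictStalkMap π ⟨(J.support : Set X)ᶜ, J.support.isClosed.isOpen_compl⟩
      ⟨x', hmem⟩)).mp ((MorphismProperty.isomorphisms.iff _).mpr inferInstance)

/-- SURGERY GLUE, OFF THE CENTRE (registered stub `stub_isBlowupStalkOffSupport`): if
`π : X' → X` is a blowing up along the ideal sheaf `J` (universal property, `IsBlowup`) and the
point `x' ∈ X'` does not lie over the centre `supp J`, then the stalk `𝒪_{X', x'}` is
ring-isomorphic to `𝒪_{X, π x'}` — the blowing up is an isomorphism over `X ∖ supp J`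
(Stacks 02OS), so its stalk map at `x'` is an isomorphism. [cite: StacksProject, Tag 02OS] -/
theorem stub_isBlowupStalkOffSupport : ∀ (X X' : Scheme.{0}) (J : X.IdealSheafData) (π : X' ⟶ X),
    IsBlowup π J → ∀ x' : X', π.base x' ∉ (J.support : Set X) →
      Nonempty (X'.presheaf.stalk x' ≃+* X.presheaf.stalk (π.base x')) := by
  intro X X' J π hπ x' hx'
  haveI := isIso_stalkMap_of_not_mem_support hπ x' hx'
  exact ⟨(asIso (π.stalkMap x')).commRingCatIsoToRingEquiv.symm⟩

end Summit.ResolutionOfSingularities.ResolutionOfSingularities.Theorems.FInjectiveMacaulayfication.IsBlowupStalkOffSupport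

end
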